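import Mathlib
import Literature.Analysis.FluidPDE.TypeIAncientMild
import Summits.NavierStokesRegularity.NavierStokesRegularity.Theorems.ScenarioCensusPitchDefectGaugeTools
import HarnessLib

/-!
# Census row A8t, line «pitch-defect»: the period average of a helical Type-I field (stub S3a1)

Support file for the scenario census of `NavierStokesRegularity` (row A8t, line «pitch-defect»,
stub S3a1 `stub_avgStructure`; KEY-NS #101 (2)), in the moving-axis form produced by
`PitchDefect.helicalGauge` (`ScenarioCensusPitchDefectGauge.lean`).

PROVED, `exists_pitchAverage`: let `V ∈ IsTypeIAncientMild C'` be a genuine Type-I ancient mild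
field whose slice `V(τ)` is helically symmetric with pitch `h ≠ 0` about the vertical axis through
`−A(τ)` (`V(τ, R_θ y + (R_θ A(τ) − A(τ) + hθ e₃)) = R_θ V(τ,y)`), with the gradient bound
`‖∇V(τ)‖ ≤ C₁/(−τ)` (stub S2). Then the PERIOD AVERAGE along the axis,
`W(τ, y) = (2π|h|)⁻¹ ∫₀^{2π|h|} V(τ, y + σ e₃) dσ`, is a field with:
jointly continuous on the open slab; `C¹` slices with `‖∇W(τ)‖ ≤ C₁/(−τ)` and `div W(τ) = 0`;
`‖W(τ)‖ ≤ C'/√(−τ)`; `z`-INDEPENDENT (`W(τ, y + s e₃) = W(τ, y)`: one full turn of the screw is the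
translation by `2πh e₃`, so the slices are periodic along the axis); rotation-EQUIVARIANT about the
axis through `−A(τ)` (the period average of a helical field is its rotation average); and the
DEFECT bound `‖V(τ, y) − W(τ, y)‖ ≤ 2π|h| C₁/(−τ)` (mean value along the period) — one power of
`√(−τ)` below the Type-I scale. Packaged as an existential statement (no new definition).

No summit statement and no census row is proved here; nothing here is a claim about NS regularity.
-/

-- the summit and its single problem share the name (D-0017 nested layout)
set_option linter.dupNamespace false

noncomputable section

open MeasureTheory Set Function Filter Metric intervalIntegral
open scoped Topology ENNReal NNReal

namespace Summit.NavierStokesRegularity.NavierStokesRegularity.Theorems.ScenarioCensus.PitchDefect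

open Literature.Analysis Literature.Analysis.FluidPDE

/-- **The period average of a helical genuine Type-I field (stub S3a1 of «pitch-defect»,
moving-axis form).** See the module docstring for the list of properties.
[cite: KochNadirashviliSereginSverak2009, §1 (1.5) (screw motions as symmetries of NS; arXiv:0709.3599)] -/
theorem exists_pitchAverage {h C' C₁ : ℝ} (hh : h ≠ 0)
    {V : ℝ → EuclideanSpace ℝ (Fin 3) → EuclideanSpace ℝ (Fin 3)}
    {A : ℝ → EuclideanSpace ℝ (Fin 3)} (hV : IsTypeIAncientMild C' V)
    (hhel : ∀ τ < 0, ∀ (θ : ℝ) (y : EuclideanSpace ℝ (Fin 3)),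
      V τ (rotZ θ y + (rotZ θ (A τ) - A τ + (h * θ) • EuclideanSpace.single 2 (1 : ℝ))) =
        rotZ θ (V τ y))
    (hC₁ : ∀ τ < 0, ∀ y, ‖fderiv ℝ (V τ) y‖ ≤ C₁ / (-τ)) :
    ∃ W : ℝ → EuclideanSpace ℝ (Fin 3) → EuclideanSpace ℝ (Fin 3),
      ContinuousOn (uncurry W) (Iio 0 ×ˢ univ) ∧
      (∀ τ < 0, ContDiff ℝ 1 (W τ)) ∧
      (∀ τ < 0, ∀ y, ‖W τ y‖ ≤ C' / Real.sqrt (-τ)) ∧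
      (∀ τ < 0, ∀ y, ‖fderiv ℝ (W τ) y‖ ≤ C₁ / (-τ)) ∧
      (∀ τ < 0, VectorCalculus.IsDivFree (W τ)) ∧
      (∀ τ < 0, ∀ (s : ℝ) (y : EuclideanSpace ℝ (Fin 3)),
        W τ (y + s • EuclideanSpace.single 2 (1 : ℝ)) = W τ y) ∧
      (∀ τ < 0, ∀ (θ : ℝ) (y : EuclideanSpace ℝ (Fin 3)),
        W τ (rotZ θ (y + A τ) - A τ) = rotZ θ (W τ y)) ∧
      (∀ τ < 0, ∀ y, ‖V τ y - W τ y‖ ≤ 2 * Real.pi * |h| * C₁ / (-τ)) := by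
  -- one full turn is the identity (also `Theorems.aeToExact_rotZ_two_pi`, not imported here)
  have rotZ_two_pi : ∀ y : EuclideanSpace ℝ (Fin 3), rotZ (2 * Real.pi) y = y := fun y => by
    ext i
    fin_cases i <;> simp [rotZ, Real.cos_two_pi, Real.sin_two_pi]
  -- ## notation and the period
  set e3 : EuclideanSpace ℝ (Fin 3) := EuclideanSpace.single 2 (1 : ℝ) with he3_def
  set L : ℝ := 2 * Real.pi * |h| with hL_def
  have hLpos : 0 < L := by rw [hL_def]; positivity
  have he3n : ‖e3‖ = 1 := by
    simp [he3_def]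
  -- slices of `V`
  have hVc : ∀ τ < 0, Continuous (V τ) := fun τ hτ => hV.continuous_slice hτ
  have hVd : ∀ τ < 0, Differentiable ℝ (V τ) := fun τ hτ =>
    (hV.contDiff_slice hτ).differentiable (by simp)
  have hVfd : ∀ τ < 0, Continuous (fderiv ℝ (V τ)) := fun τ hτ =>
    (hV.contDiff_slice hτ).continuous_fderiv (by simp)
  have hC₁0 : ∀ τ < 0, 0 ≤ C₁ / (-τ) := fun τ hτ => (norm_nonneg _).trans (hC₁ τ hτ 0)
  -- ## periodicity along the axis: `V τ (y + (σ + 2πh) e₃) = V τ (y + σ e₃)`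
  have hper : ∀ τ < 0, ∀ y : EuclideanSpace ℝ (Fin 3),
      Function.Periodic (fun σ : ℝ => V τ (y + σ • e3)) (2 * Real.pi * h) := by
    intro τ hτ y σ
    have key := hhel τ hτ (2 * Real.pi) (y + σ • e3)
    rw [rotZ_two_pi, rotZ_two_pi, rotZ_two_pi, sub_self, zero_add] at key
    simp only
    rw [show y + (σ + 2 * Real.pi * h) • e3 = y + σ • e3 + (h * (2 * Real.pi)) • e3 by
      rw [add_smul, add_assoc]; congr 2; ring]
    exact key
  have hperL : ∀ τ < 0, ∀ y : EuclideanSpace ℝ (Fin 3),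
      Function.Periodic (fun σ : ℝ => V τ (y + σ • e3)) L := by
    intro τ hτ y
    rcases le_or_gt 0 h with hh0 | hh0
    · rw [hL_def, abs_of_nonneg hh0]; exact hper τ hτ y
    · rw [hL_def, abs_of_neg hh0, show 2 * Real.pi * -h = -(2 * Real.pi * h) by ring]
      exact (hper τ hτ y).neg
  -- ## the average
  set W : ℝ → EuclideanSpace ℝ (Fin 3) → EuclideanSpace ℝ (Fin 3) :=
    fun τ y => L⁻¹ • ∫ σ in (0 : ℝ)..L, V τ (y + σ • e3) with hW_def
  have hgc : ∀ τ < 0, ∀ y : EuclideanSpace ℝ (Fin 3), Continuous fun σ : ℝ => V τ (y + σ • e3) :=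
    fun τ hτ y => (hVc τ hτ).comp (continuous_const.add (continuous_id.smul continuous_const))
  have hgi : ∀ τ < 0, ∀ (y : EuclideanSpace ℝ (Fin 3)) (a b : ℝ),
      IntervalIntegrable (fun σ : ℝ => V τ (y + σ • e3)) volume a b :=
    fun τ hτ y a b => (hgc τ hτ y).intervalIntegrable a b
  -- ## (1) z-independence
  have hz : ∀ τ < 0, ∀ (s : ℝ) (y : EuclideanSpace ℝ (Fin 3)), W τ (y + s • e3) = W τ y := by
    intro τ hτ s y
    simp only [hW_def]
    congr 1
    have h1 : (fun σ : ℝ => V τ (y + s • e3 + σ • e3)) = fun σ => V τ (y + (σ + s) • e3) := by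
      funext σ; rw [add_smul, add_assoc, add_comm (s • e3)]
    have h1' : (∫ σ in (0 : ℝ)..L, V τ (y + (σ + s) • e3)) =
        ∫ σ in (0 : ℝ) + s..L + s, V τ (y + σ • e3) :=
      intervalIntegral.integral_comp_add_right (fun σ => V τ (y + σ • e3)) s
    rw [h1, h1', zero_add, show L + s = s + L by ring]
    have h2 := (hperL τ hτ y).intervalIntegral_add_eq s 0
    rw [zero_add] at h2
    exact h2
  -- ## (2) rotation equivariance about the axis through `-A τ`
  have hrot : ∀ τ < 0, ∀ (θ : ℝ) (y : EuclideanSpace ℝ (Fin 3)),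
      W τ (rotZ θ (y + A τ) - A τ) = rotZ θ (W τ y) := by
    intro τ hτ θ y
    have h1 : ∀ σ : ℝ, V τ (rotZ θ (y + A τ) - A τ + σ • e3) =
        rotZ θ (V τ (y + (σ - h * θ) • e3)) := by
      intro σ
      have key := hhel τ hτ θ (y + (σ - h * θ) • e3)
      rw [← key]
      congr 1
      have eA : rotZ θ (y + A τ) = rotZ θ y + rotZ θ (A τ) := by
        rw [← rotZL_apply, map_add]; rfl
      have eB : rotZ θ (y + (σ - h * θ) • e3) = rotZ θ y + (σ - h * θ) • e3 := by
        rw [← rotZL_apply, map_add, rotZL_apply, rotZL_apply, he3_def, rotZ_smul_single]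
      rw [eA, eB, sub_smul]
      abel
    have hI : (∫ σ in (0 : ℝ)..L, V τ (rotZ θ (y + A τ) - A τ + σ • e3)) =
        ∫ σ in (0 : ℝ)..L, rotZ θ (V τ (y + (σ - h * θ) • e3)) :=
      intervalIntegral.integral_congr (μ := volume) fun σ _ => h1 σ
    have hgc' : Continuous fun σ : ℝ => V τ (y + (σ - h * θ) • e3) :=
      (hVc τ hτ).comp (continuous_const.add ((continuous_id.sub continuous_const).smul
        continuous_const))
    have h2 : (∫ σ in (0 : ℝ)..L, rotZ θ (V τ (y + (σ - h * θ) • e3))) =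
        rotZ θ (∫ σ in (0 : ℝ)..L, V τ (y + (σ - h * θ) • e3)) := by
      have := (rotZL θ).intervalIntegral_comp_comm (μ := volume)
        (hgc'.intervalIntegrable (μ := volume) 0 L)
      simpa only [rotZL_apply] using this
    have h3 : (∫ σ in (0 : ℝ)..L, V τ (y + (σ - h * θ) • e3)) =
        ∫ σ in (0 : ℝ)..L, V τ (y + σ • e3) := by
      have h4 : (∫ σ in (0 : ℝ)..L, V τ (y + (σ - h * θ) • e3)) =
          ∫ σ in (0 : ℝ) - h * θ..L - h * θ, V τ (y + σ • e3) :=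
        intervalIntegral.integral_comp_sub_right (fun σ => V τ (y + σ • e3)) (h * θ)
      rw [h4, zero_sub, show L - h * θ = -(h * θ) + L by ring]
      have h5 := (hperL τ hτ y).intervalIntegral_add_eq (-(h * θ)) 0
      rw [zero_add] at h5
      exact h5
    show L⁻¹ • (∫ σ in (0 : ℝ)..L, V τ (rotZ θ (y + A τ) - A τ + σ • e3)) =
      rotZ θ (L⁻¹ • ∫ σ in (0 : ℝ)..L, V τ (y + σ • e3))
    rw [hI, h2, h3, ← rotZL_apply θ (L⁻¹ • _), map_smul, rotZL_apply]
  -- ## (3) the derivative of the average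
  have hder : ∀ τ < 0, ∀ y : EuclideanSpace ℝ (Fin 3),
      HasFDerivAt (W τ) (L⁻¹ • ∫ σ in (0 : ℝ)..L, fderiv ℝ (V τ) (y + σ • e3)) y := by
    intro τ hτ y
    have key : HasFDerivAt (fun x : EuclideanSpace ℝ (Fin 3) => ∫ σ in (0 : ℝ)..L, V τ (x + σ • e3))
        (∫ σ in (0 : ℝ)..L, fderiv ℝ (V τ) (y + σ • e3)) y := by
      refine intervalIntegral.hasFDerivAt_integral_of_dominated_of_fderiv_le
        (F := fun (x : EuclideanSpace ℝ (Fin 3)) (σ : ℝ) => V τ (x + σ • e3))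
        (F' := fun (x : EuclideanSpace ℝ (Fin 3)) (σ : ℝ) => fderiv ℝ (V τ) (x + σ • e3))
        (bound := fun _ => C₁ / (-τ)) univ_mem ?_ (hgi τ hτ y 0 L) ?_ ?_ ?_ ?_
      · exact Eventually.of_forall fun x => (hgc τ hτ x).aestronglyMeasurable
      · exact ((hVfd τ hτ).comp (continuous_const.add (continuous_id.smul continuous_const))
          ).aestronglyMeasurable
      · exact Eventually.of_forall fun σ _ x _ => hC₁ τ hτ _
      · exact intervalIntegrable_const
      · refine Eventually.of_forall fun σ _ x _ => ?_
        have h1 : HasFDerivAt (V τ) (fderiv ℝ (V τ) (x + σ • e3)) (x + σ • e3) :=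
          (hVd τ hτ _).hasFDerivAt
        have h2 : HasFDerivAt (fun z : EuclideanSpace ℝ (Fin 3) => z + σ • e3)
            (ContinuousLinearMap.id ℝ _) x := (hasFDerivAt_id x).add_const _
        have h3 := h1.comp x h2
        rwa [ContinuousLinearMap.comp_id] at h3
    exact key.const_smul L⁻¹
  have hfderiv : ∀ τ < 0, ∀ y : EuclideanSpace ℝ (Fin 3),
      fderiv ℝ (W τ) y = L⁻¹ • ∫ σ in (0 : ℝ)..L, fderiv ℝ (V τ) (y + σ • e3) :=
    fun τ hτ y => (hder τ hτ y).fderiv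
  -- ## (4) gradient bound
  have hgrad : ∀ τ < 0, ∀ y, ‖fderiv ℝ (W τ) y‖ ≤ C₁ / (-τ) := by
    intro τ hτ y
    rw [hfderiv τ hτ y, norm_smul, norm_inv, Real.norm_of_nonneg hLpos.le]
    have h1 : ‖∫ σ in (0 : ℝ)..L, fderiv ℝ (V τ) (y + σ • e3)‖ ≤ C₁ / (-τ) * |L - 0| :=
      intervalIntegral.norm_integral_le_of_norm_le_const fun σ _ => hC₁ τ hτ _
    rw [sub_zero, abs_of_pos hLpos] at h1
    calc L⁻¹ * ‖∫ σ in (0 : ℝ)..L, fderiv ℝ (V τ) (y + σ • e3)‖ ≤ L⁻¹ * (C₁ / (-τ) * L) := by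
          gcongr
      _ = C₁ / (-τ) := by field_simp
  -- ## (5) C¹
  have hC1 : ∀ τ < 0, ContDiff ℝ 1 (W τ) := by
    intro τ hτ
    rw [contDiff_one_iff_fderiv]
    refine ⟨fun y => (hder τ hτ y).differentiableAt, ?_⟩
    have e : fderiv ℝ (W τ) = fun y => L⁻¹ • ∫ σ in (0 : ℝ)..L, fderiv ℝ (V τ) (y + σ • e3) :=
      funext (hfderiv τ hτ)
    rw [e]
    have hu : Continuous (Function.uncurry fun (y : EuclideanSpace ℝ (Fin 3)) (σ : ℝ) =>
        fderiv ℝ (V τ) (y + σ • e3)) :=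
      (hVfd τ hτ).comp (continuous_fst.add (continuous_snd.smul continuous_const))
    have hc : Continuous fun y : EuclideanSpace ℝ (Fin 3) =>
        ∫ σ in (0 : ℝ)..L, fderiv ℝ (V τ) (y + σ • e3) :=
      intervalIntegral.continuous_parametric_intervalIntegral_of_continuous' (μ := volume) hu 0 L
    exact hc.const_smul L⁻¹
  -- ## (6) divergence free
  have hdiv : ∀ τ < 0, VectorCalculus.IsDivFree (W τ) := by
    intro τ hτ y
    -- the trace as a continuous linear functional on `ℝ³ →L ℝ³`
    let T : (EuclideanSpace ℝ (Fin 3) →L[ℝ] EuclideanSpace ℝ (Fin 3)) →L[ℝ] ℝ :=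
      LinearMap.toContinuousLinearMap
        ((LinearMap.trace ℝ (EuclideanSpace ℝ (Fin 3))).comp (ContinuousLinearMap.coeLM ℝ))
    have hT : ∀ (f : EuclideanSpace ℝ (Fin 3) → EuclideanSpace ℝ (Fin 3)) (z : EuclideanSpace ℝ (Fin 3)),
        T (fderiv ℝ f z) = VectorCalculus.divergence f z := fun _ _ => rfl
    rw [← hT, hfderiv τ hτ y, map_smul]
    have hint : IntervalIntegrable (fun σ : ℝ => fderiv ℝ (V τ) (y + σ • e3)) volume 0 L :=
      ((hVfd τ hτ).comp (continuous_const.add (continuous_id.smul continuous_const))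
        ).intervalIntegrable _ _
    rw [← T.intervalIntegral_comp_comm hint]
    have h0 : (fun σ : ℝ => T (fderiv ℝ (V τ) (y + σ • e3))) = fun _ => (0 : ℝ) := by
      funext σ
      rw [hT]
      exact hV.isDivFree hτ _
    rw [h0, intervalIntegral.integral_const, smul_zero, smul_eq_mul, mul_zero]
  -- ## (7) Type-I bound
  have hbd : ∀ τ < 0, ∀ y, ‖W τ y‖ ≤ C' / Real.sqrt (-τ) := by
    intro τ hτ y
    simp only [hW_def]
    rw [norm_smul, norm_inv, Real.norm_of_nonneg hLpos.le]
    have h1 : ‖∫ σ in (0 : ℝ)..L, V τ (y + σ • e3)‖ ≤ C' / Real.sqrt (-τ) * |L - 0| :=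
      intervalIntegral.norm_integral_le_of_norm_le_const fun σ _ => hV.norm_le hτ _
    rw [sub_zero, abs_of_pos hLpos] at h1
    calc L⁻¹ * ‖∫ σ in (0 : ℝ)..L, V τ (y + σ • e3)‖ ≤ L⁻¹ * (C' / Real.sqrt (-τ) * L) := by
          gcongr
      _ = C' / Real.sqrt (-τ) := by field_simp
  -- ## (8) the defect bound (mean value along the period)
  have hdef : ∀ τ < 0, ∀ y, ‖V τ y - W τ y‖ ≤ 2 * Real.pi * |h| * C₁ / (-τ) := by
    intro τ hτ y
    have h1 : V τ y - W τ y = L⁻¹ • ∫ σ in (0 : ℝ)..L, (V τ y - V τ (y + σ • e3)) := by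
      rw [intervalIntegral.integral_sub intervalIntegrable_const (hgi τ hτ y 0 L),
        intervalIntegral.integral_const, sub_zero, smul_sub, smul_smul, inv_mul_cancel₀ hLpos.ne',
        one_smul]
    have h2 : ∀ σ ∈ Set.uIoc (0 : ℝ) L, ‖V τ y - V τ (y + σ • e3)‖ ≤ C₁ / (-τ) * L := by
      intro σ hσ
      rw [Set.uIoc_of_le hLpos.le] at hσ
      have hmv : ‖V τ (y + σ • e3) - V τ y‖ ≤ C₁ / (-τ) * ‖y + σ • e3 - y‖ :=
        (convex_univ).norm_image_sub_le_of_norm_fderiv_le (fun x _ => (hVd τ hτ x))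
          (fun x _ => hC₁ τ hτ x) (mem_univ y) (mem_univ _)
      rw [add_sub_cancel_left, norm_smul, he3n, mul_one, Real.norm_of_nonneg hσ.1.le] at hmv
      rw [norm_sub_rev]
      exact hmv.trans (mul_le_mul_of_nonneg_left hσ.2 (hC₁0 τ hτ))
    have h3 : ‖∫ σ in (0 : ℝ)..L, (V τ y - V τ (y + σ • e3))‖ ≤ C₁ / (-τ) * L * |L - 0| :=
      intervalIntegral.norm_integral_le_of_norm_le_const h2
    rw [sub_zero, abs_of_pos hLpos] at h3
    rw [h1, norm_smul, norm_inv, Real.norm_of_nonneg hLpos.le]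
    calc L⁻¹ * ‖∫ σ in (0 : ℝ)..L, (V τ y - V τ (y + σ • e3))‖ ≤ L⁻¹ * (C₁ / (-τ) * L * L) := by
          gcongr
      _ = L * C₁ / (-τ) := by field_simp
      _ = 2 * Real.pi * |h| * C₁ / (-τ) := by rw [hL_def]
  -- ## (9) joint continuity on the open slab
  have hcont : ContinuousOn (uncurry W) (Iio 0 ×ˢ univ) := by
    rintro ⟨τ₀, y₀⟩ ⟨hτ₀, -⟩
    have hτ₀' : τ₀ < 0 := hτ₀
    refine ContinuousAt.continuousWithinAt ?_
    have e : uncurry W = fun p : ℝ × EuclideanSpace ℝ (Fin 3) =>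
        L⁻¹ • ∫ σ in (0 : ℝ)..L, V p.1 (p.2 + σ • e3) := by
      funext p; rfl
    rw [e]
    refine ContinuousAt.const_smul ?_ L⁻¹
    -- points near `(τ₀, y₀)` have `p.1 < τ₀ / 2 < 0`
    have hnb : ∀ᶠ p : ℝ × EuclideanSpace ℝ (Fin 3) in 𝓝 (τ₀, y₀), p.1 < τ₀ / 2 := by
      have : Iio (τ₀ / 2) ×ˢ (univ : Set (EuclideanSpace ℝ (Fin 3))) ∈ 𝓝 (τ₀, y₀) :=
        (isOpen_Iio.prod isOpen_univ).mem_nhds ⟨by show τ₀ < τ₀ / 2; linarith, mem_univ _⟩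
      filter_upwards [this] with p hp
      exact hp.1
    refine intervalIntegral.continuousAt_of_dominated_interval
      (bound := fun _ => C' / Real.sqrt (-(τ₀ / 2))) ?_ ?_ intervalIntegrable_const ?_
    · filter_upwards [hnb] with p hp
      exact (hgc p.1 (by linarith) p.2).aestronglyMeasurable
    · filter_upwards [hnb] with p hp
      refine Eventually.of_forall fun σ _ => ?_
      have hp0 : p.1 < 0 := by linarith
      refine (hV.norm_le hp0 _).trans ?_
      exact div_le_div_of_nonneg_left hV.nonneg (Real.sqrt_pos.2 (by linarith))
        (Real.sqrt_le_sqrt (by linarith))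
    · refine Eventually.of_forall fun σ _ => ?_
      have hmem : (τ₀, y₀ + σ • e3) ∈ Iio (0 : ℝ) ×ˢ (univ : Set (EuclideanSpace ℝ (Fin 3))) :=
        ⟨hτ₀', mem_univ _⟩
      have hca : ContinuousAt (uncurry V) (τ₀, y₀ + σ • e3) :=
        hV.continuousOn_uncurry.continuousAt ((isOpen_Iio.prod isOpen_univ).mem_nhds hmem)
      have hmap : ContinuousAt (fun p : ℝ × EuclideanSpace ℝ (Fin 3) => (p.1, p.2 + σ • e3))
          (τ₀, y₀) := (continuous_fst.prodMk (continuous_snd.add continuous_const)).continuousAt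
      have hcomp := ContinuousAt.comp_of_eq hca hmap rfl
      exact hcomp
  exact ⟨W, hcont, hC1, hbd, hgrad, hdiv, hz, hrot, hdef⟩

end Summit.NavierStokesRegularity.NavierStokesRegularity.Theorems.ScenarioCensus.PitchDefect

end
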